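import Mathlib

/-!
# `T4Continuum.ShellMeasureRayLogIntegral` — THE FLUCTUATION-DRESSED NON-WILSON PART NEEDS NO ANALYTICITY RADIUS:
# END-II's ray binder `hE` passes through `−log ∫ e^{A(x,ω)} dμ(ω)` from ω-UNIFORM ray bounds of the exponent
(cell `pub-balaban`, sub-cell `t4`, spine estimate NE7c (node U5b); owner lineage `b2b-balaban-t4-ne7c-p1`, gen 31,
row S78 of `t4/b2b-balaban-t4-ne7c-p1/LEAVES-NE7c-P1.md`; ADDITIVE — imports Mathlib ONLY; [folklore]; 0 `def`,
0 `def … : Prop`, 0 sorry, 0 citations)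

HONEST FRAMING.  Finite four-torus programme, rung (B)+1 only — NOT infinite volume, NOT a mass gap, NOT the Clay
problem, NOT summit progress; (B), `BetaPertHyp`, (B^μ) not consumed.  NE7c (`T4IndicatorShell.ShellWeightBound`) is NOT
PRINTED in [Balaban 1983–89] and NOT PROVED; «NE7c ⇐ the named binders» (trigger c3).  Nothing printed is asserted;
no estimate of Bałaban's is discharged; this file is one-screen real analysis (monotonicity of `∫` and `log`).

THE POINT (owner audit item (γ1) of gen 31, WALL v2.1 §2b row `B_E`).  After RULINGS R-ne7cp1-g31-1∕-2 the live-level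
END of record candidate carries the WHOLE sectioned log-weight of ONE [Balaban1988Convergent] (2.18)-term through ONE
binder pair `hE : ∀ x ∈ W, ∀ c, 1∕2 ≤ c → c ≤ 1 → 𝓔 (c • x) ≤ 𝓔 x + (1 − c)·B_𝓔`, `0 ≤ B_𝓔`
(`ShellMeasureLevelAssembly.slotAntiConcentration_of_levelData`).  Its suppliers of record — S16
`ShellMeasureRayWiring.rayBound_of_analytic_terms`, S71 `ShellMeasureRayTermsPinned(Landau)`, S72∕S74 (Wilson square terms)
— produce it from per-term ANALYTICITY on the complexified ray (Cauchy).  But a (2.18)-term's density is DRESSED by the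
fluctuation operations `T_k` ((2.19)–(2.22)): as a function of the block variable it is `∫ dμ(ω) g(ω) e^{A(x,ω)}`
(`ω` = the term's integrated fluctuation variables with their x-INDEPENDENT characteristic functions `g ≥ 0` — the
(W1)∕LiveWindow reading: only the last `N₁` levels' indicators read the current field; `A(x,ω)` = the effective action
`A_k(g_k^{−2}, U_k(V(x)); ω)` incl. the boundary terms `𝐁_k(U_k, A)`), and the analyticity RADIUS of
`w ↦ −log ∫ g e^{A(w•x,·)} dμ` is controlled by the TOTAL oscillation of `A` along the complex ray (the integral may
vanish once `|Im A| ≳ π`) — a sum over ALL plaquettes and terms, NOT small.  THIS FILE removes the question: `hE` is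
MONOTONE under `−log ∫ e^{·}` — if the exponent obeys the ray bound ω-UNIFORMLY (`A(x,ω) ≤ A(c•x,ω) + (1−c)·B` for every
`ω`; for the fluctuation-dressed terms a sum of the same located per-term∕per-plaquette REAL ray-Lipschitz constants
that S71∕S74 display, now read at each fixed `ω`), then `𝓔 := −log ∫ g e^{A}` obeys `hE` with the SAME `B` — no
analyticity of `𝓔`, no radius, no lower bound on the integral beyond positivity.  So the `T_k`-dressed non-Wilson part
of WALL §2 W-b (G-ne7cp1-17 «background-dependence of the fluctuation factors») enters END-II in the currency
«ω-uniform ray bound of the integrand's exponent», and the located inputs stay the displayed per-term pairs.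
* §1 `integral_exp_le_of_rayBound` (`∫ g e^{A x} ≤ e^{(1−c)B}·∫ g e^{A(c•x)}`), **`rayBound_of_logIntegral`** (END-II's
  `hE` LITERALLY for `𝓔 x := −log ∫ g(ω) e^{A x ω} dμ`), `rayBound_of_logIntegral_abs` (from the two-sided ω-uniform
  bound `|A(c•x,ω) − A(x,ω)| ≤ (1−c)B`); §2 `rayBound_add` (two ray bounds add — the analytic part ⊕ the log-integral
  part ⟹ ONE pair for the END; cf. S74's `hE_add`); §3 non-vacuity toy.
NOTHING in the countdown moves; NE7c NOT PROVED; spine PROVED 0∕9.  HONEST DEPENDENCY (cell): continuum YM on T⁴ ⇐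
BetaPertH ∧ nine spine estimates (0/9 proved); BetaPertH ⇐ (D1) ∧ (D4) ∧ CAP+tail; G-an2-4 gates asym, D1 and NE2/3/4.
-/

noncomputable section

open MeasureTheory Set

namespace Summit.QuantumFields.BalabanUV.T4Continuum.ShellMeasureRayLogIntegral

variable {E Ω : Type*} [AddCommGroup E] [Module ℝ E] [MeasurableSpace Ω]

/-! ## §1 The ray bound passes through `−log ∫ g e^{A} dμ` -/

/-- **THE INTEGRAL COMPARISON**: if `A x ω ≤ A (c • x) ω + t` for every `ω` and `g ≥ 0`, then
`∫ g·e^{A x} ≤ e^{t}·∫ g·e^{A (c•x)}` (the right-hand integrand integrable). [folklore] -/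
theorem integral_exp_le_of_rayBound (μ : Measure Ω) {g : Ω → ℝ} (hg : ∀ ω, 0 ≤ g ω) {a a' : Ω → ℝ} {t : ℝ}
    (hint : Integrable (fun ω => g ω * Real.exp (a' ω)) μ) (hle : ∀ ω, a ω ≤ a' ω + t) :
    ∫ ω, g ω * Real.exp (a ω) ∂μ ≤ Real.exp t * ∫ ω, g ω * Real.exp (a' ω) ∂μ := by
  rw [← integral_const_mul]
  by_cases hi : Integrable (fun ω => g ω * Real.exp (a ω)) μ
  · refine integral_mono hi (hint.const_mul _) fun ω => ?_
    have h1 : Real.exp (a ω) ≤ Real.exp t * Real.exp (a' ω) := by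
      rw [← Real.exp_add]; exact Real.exp_le_exp.2 (by linarith [hle ω])
    calc g ω * Real.exp (a ω) ≤ g ω * (Real.exp t * Real.exp (a' ω)) := mul_le_mul_of_nonneg_left h1 (hg ω)
      _ = Real.exp t * (g ω * Real.exp (a' ω)) := by ring
  · rw [integral_undef hi]
    exact integral_nonneg fun ω => mul_nonneg (Real.exp_pos _).le (mul_nonneg (hg ω) (Real.exp_pos _).le)

/-- **END-II's `hE` FOR A LOG-INTEGRAL (FLUCTUATION-DRESSED) TERM, FROM AN ω-UNIFORM RAY BOUND OF THE EXPONENT.**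
Data: a measure `μ` on the fluctuation variables, an x-INDEPENDENT factor `g ≥ 0` (their characteristic functions), an
exponent `A : E → Ω → ℝ` with `ω ↦ g ω·e^{A y ω}` integrable and of POSITIVE integral at every ray point `y = c • x`
(`x ∈ W`, `c ∈ [1∕2, 1]`), and the ω-UNIFORM ray bound `A x ω ≤ A (c • x) ω + (1 − c)·B`.  CONCLUSION, for
`𝓔 y := −log ∫ g ω·e^{A y ω} dμ`: `∀ x ∈ W, ∀ c, 1∕2 ≤ c → c ≤ 1 → 𝓔 (c • x) ≤ 𝓔 x + (1 − c)·B` — END-II's `hE`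
LITERALLY.  No analyticity, no radius. [folklore] -/
theorem rayBound_of_logIntegral (μ : Measure Ω) {W : Set E} {g : Ω → ℝ} (hg : ∀ ω, 0 ≤ g ω) (A : E → Ω → ℝ)
    {B : ℝ}
    (hint : ∀ x ∈ W, ∀ c : ℝ, 1 / 2 ≤ c → c ≤ 1 → Integrable (fun ω => g ω * Real.exp (A (c • x) ω)) μ)
    (hpos : ∀ x ∈ W, ∀ c : ℝ, 1 / 2 ≤ c → c ≤ 1 → 0 < ∫ ω, g ω * Real.exp (A (c • x) ω) ∂μ)
    (hA : ∀ x ∈ W, ∀ c : ℝ, 1 / 2 ≤ c → c ≤ 1 → ∀ ω, A x ω ≤ A (c • x) ω + (1 - c) * B) :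
    ∀ x ∈ W, ∀ c : ℝ, 1 / 2 ≤ c → c ≤ 1 →
      -Real.log (∫ ω, g ω * Real.exp (A (c • x) ω) ∂μ) ≤
        -Real.log (∫ ω, g ω * Real.exp (A x ω) ∂μ) + (1 - c) * B := by
  intro x hx c hc0 hc1
  have hIc := hpos x hx c hc0 hc1
  have hI1 : 0 < ∫ ω, g ω * Real.exp (A x ω) ∂μ := by
    simpa only [one_smul] using hpos x hx 1 (by norm_num) le_rfl
  have hcmp : ∫ ω, g ω * Real.exp (A x ω) ∂μ ≤
      Real.exp ((1 - c) * B) * ∫ ω, g ω * Real.exp (A (c • x) ω) ∂μ :=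
    integral_exp_le_of_rayBound μ hg (hint x hx c hc0 hc1) (hA x hx c hc0 hc1)
  have hlog : Real.log (∫ ω, g ω * Real.exp (A x ω) ∂μ) ≤
      (1 - c) * B + Real.log (∫ ω, g ω * Real.exp (A (c • x) ω) ∂μ) := by
    have h := Real.log_le_log hI1 hcmp
    rwa [Real.log_mul (Real.exp_pos _).ne' hIc.ne', Real.log_exp] at h
  linarith

/-- **THE TWO-SIDED FORM**: an ω-uniform bound `|A (c • x) ω − A x ω| ≤ (1 − c)·B` gives the same `hE` (and the
reverse inequality, not needed by END-II). [folklore] -/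
theorem rayBound_of_logIntegral_abs (μ : Measure Ω) {W : Set E} {g : Ω → ℝ} (hg : ∀ ω, 0 ≤ g ω) (A : E → Ω → ℝ)
    {B : ℝ}
    (hint : ∀ x ∈ W, ∀ c : ℝ, 1 / 2 ≤ c → c ≤ 1 → Integrable (fun ω => g ω * Real.exp (A (c • x) ω)) μ)
    (hpos : ∀ x ∈ W, ∀ c : ℝ, 1 / 2 ≤ c → c ≤ 1 → 0 < ∫ ω, g ω * Real.exp (A (c • x) ω) ∂μ)
    (hA : ∀ x ∈ W, ∀ c : ℝ, 1 / 2 ≤ c → c ≤ 1 → ∀ ω, |A (c • x) ω - A x ω| ≤ (1 - c) * B) :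
    ∀ x ∈ W, ∀ c : ℝ, 1 / 2 ≤ c → c ≤ 1 →
      -Real.log (∫ ω, g ω * Real.exp (A (c • x) ω) ∂μ) ≤
        -Real.log (∫ ω, g ω * Real.exp (A x ω) ∂μ) + (1 - c) * B :=
  rayBound_of_logIntegral μ hg A hint hpos fun x hx c hc0 hc1 ω => by
    have h := (abs_le.1 (hA x hx c hc0 hc1 ω)).1
    linarith

omit [MeasurableSpace Ω] in
/-- the constant of an ω-uniform two-sided bound is nonnegative as soon as the window is nonempty (END-II's `hB𝓔`;
read it at `c = 1∕2`). [folklore] -/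
theorem rayConst_nonneg_of_abs {W : Set E} {x : E} (hx : x ∈ W) (A : E → Ω → ℝ) {B : ℝ} (ω : Ω)
    (hA : ∀ x ∈ W, ∀ c : ℝ, 1 / 2 ≤ c → c ≤ 1 → ∀ ω, |A (c • x) ω - A x ω| ≤ (1 - c) * B) : 0 ≤ B := by
  have h := (abs_nonneg _).trans (hA x hx (1 / 2) le_rfl (by norm_num) ω)
  linarith

/-! ## §2 Ray bounds add -/

/-- **TWO RAY BOUNDS ADD**: the analytic part (S16∕S71∕S74) ⊕ the log-integral part ⟹ ONE `hE` pair for the END with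
`B = B₁ + B₂` (cf. S74's `hE_add`). [folklore] -/
theorem rayBound_add {W : Set E} {𝓔₁ 𝓔₂ : E → ℝ} {B₁ B₂ : ℝ}
    (h₁ : ∀ x ∈ W, ∀ c : ℝ, 1 / 2 ≤ c → c ≤ 1 → 𝓔₁ (c • x) ≤ 𝓔₁ x + (1 - c) * B₁)
    (h₂ : ∀ x ∈ W, ∀ c : ℝ, 1 / 2 ≤ c → c ≤ 1 → 𝓔₂ (c • x) ≤ 𝓔₂ x + (1 - c) * B₂) :
    ∀ x ∈ W, ∀ c : ℝ, 1 / 2 ≤ c → c ≤ 1 →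
      (𝓔₁ (c • x) + 𝓔₂ (c • x)) ≤ (𝓔₁ x + 𝓔₂ x) + (1 - c) * (B₁ + B₂) := by
  intro x hx c hc0 hc1
  have := h₁ x hx c hc0 hc1
  have := h₂ x hx c hc0 hc1
  linarith

/-! ## §3 Non-vacuity -/

/-- NON-VACUITY (trigger c3): on `E = ℝ`, `Ω = Unit` with the Dirac mass, `g ≡ 1`, `A x ω := x`, `W = [0,1]`, `B = 1`:
`A x − A (c x) = (1 − c) x ≤ (1 − c)·1`, the integrals are `e^{cx} > 0`, and the conclusion holds. [folklore] -/
example : ∀ x ∈ Icc (0 : ℝ) 1, ∀ c : ℝ, 1 / 2 ≤ c → c ≤ 1 →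
    -Real.log (∫ _ω : Unit, (1 : ℝ) * Real.exp (c • x) ∂Measure.dirac ()) ≤
      -Real.log (∫ _ω : Unit, (1 : ℝ) * Real.exp x ∂Measure.dirac ()) + (1 - c) * 1 := by
  refine rayBound_of_logIntegral (Measure.dirac ()) (fun _ => zero_le_one) (fun y _ => y) (fun x _ c _ _ => ?_)
    (fun x _ c _ _ => ?_) (fun x hx c hc0 hc1 _ => ?_)
  · exact integrable_dirac (a := ()) (by measurability)
  · rw [integral_dirac]; positivity
  · rw [smul_eq_mul]; nlinarith [hx.1, hx.2]

end Summit.QuantumFields.BalabanUV.T4Continuum.ShellMeasureRayLogIntegral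

end
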